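import Summits.QuantumFields.YangMills.Theorems.ScalingWindowSplitSelfNormalisedSkewnessStubTwoPointSmearingPrep
import HarnessLib

/-!
# Crux `SelfNormalisedSkewness` (stmt-QuantumFields-18944), line `Sketch`: stub `stub_twoPointSmearing`

The smeared tree-level two-point kernel
`TP(u) = ∑_{x ≠ y ∈ box 4 L} u(a x) (θu)(a y) ∑_{αα'} π_{αα'}(x - y)²` (`a²L = 1`, `θ` the time
reflection) of a reflected pair of bumps is of exact order one in the lattice spacing `a`:

* (UPPER, `twoPointSmearing_upper` of the `…Prep` file) `TP(u) ≤ C` when `supp u ⊆ {y₀ ≤ -ρ₀} ∩ B(0,R)`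
  and `2aR ≤ 1`: contributing pairs are time-separated by `≥ 2ρ₀/a`, where the kernel is
  `≤ C_K (a/2ρ₀)⁸` (`stub_twoPointKernel`, upper part), and at most `(2R/a + 1)⁸` pairs contribute;
* (LOWER, `twoPointSmearing_lower` below) `TP(u) ≥ c > 0` for `u ≥ 0` equal to `≥ 1` on the ball of
  radius `r ≤ δ₁ t₀` about `(-t₀, 0, 0, 0)` and `a ≤ a₀`: all summands are nonnegative, and on the
  sub-family of pairs `(x, x - n)` with `a x` near `(-t₀, 0⃗)` and `a n` near `(-2t₀, 0⃗)` (there are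
  `≳ (r/a)⁸` of them) both bumps are `≥ 1` while `n` lies in the cone around the time axis where the
  kernel is `≥ c₀ |n₀|⁻⁸ ≍ c₀ (a/t₀)⁸` (`stub_twoPointKernel`, lower part).

Everything is folklore; no named facts are used.
-/

noncomputable section

open scoped BigOperators
open Finset
open Literature.MathematicalPhysics.QuantumLattice (siteToE thetaTest timeReflection siteToE_apply
  thetaTest_apply timeReflection_apply)
open Literature.Probability.LatticeModels

namespace Summit.QuantumFields.YangMills.Theorems.SelfNormalisedSkewness.Negative

/-! ### Two more geometric lemmas -/

/-- Coordinatewise closeness `≤ r/2` in `ℝ⁴` gives distance `≤ r`. [folklore] -/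
theorem tps_dist_le_of_coord_le {v w : EuclideanSpace ℝ (Fin 4)} {r : ℝ} (hr : 0 ≤ r)
    (h : ∀ i, |v i - w i| ≤ r / 2) : dist v w ≤ r := by
  rw [EuclideanSpace.dist_eq, Real.sqrt_le_left hr]
  calc ∑ i, dist (v i) (w i) ^ 2 ≤ ∑ _i : Fin 4, (r / 2) ^ 2 :=
        Finset.sum_le_sum fun i _ => by
          rw [Real.dist_eq]
          exact pow_le_pow_left₀ (abs_nonneg _) (h i) 2
    _ = r ^ 2 := by
        simp only [Finset.sum_const, Finset.card_univ, Fintype.card_fin, nsmul_eq_mul]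
        push_cast
        ring

/-- Membership in the lattice cube of half-width `w` around `c` at lattice spacing `a`. [folklore] -/
theorem tps_mem_cube_iff {a w : ℝ} (ha : 0 < a) (c : Fin 4 → ℝ) (x : Site 4) :
    x ∈ Fintype.piFinset (fun i => Finset.Icc ⌈(c i - w) / a⌉ ⌊(c i + w) / a⌋) ↔
      ∀ i, |a * x i - c i| ≤ w := by
  simp only [Fintype.mem_piFinset, Finset.mem_Icc, Int.ceil_le, Int.le_floor, div_le_iff₀ ha,
    le_div_iff₀ ha, abs_le]
  refine forall_congr' fun i => ?_
  constructor <;> rintro ⟨h1, h2⟩ <;> constructor <;> linarith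

/-! ### The lower half -/

/-- **Lower half, core estimate.** For `u ≥ 0` equal to `≥ 1` on the ball of radius `r` about
`X₀ = (-t₀, 0, 0, 0)` (`0 < r ≤ t₀`, `r ≤ δ₀ t₀`), a nonnegative kernel `K` with the cone lower bound
`c₀ |n₀|⁻⁸ ≤ K(x, x - n)` and a lattice spacing `a` with `a²L = 1`, `4a ≤ r`, `8a(3t₀ + r) ≤ 1`,
`a(3t₀ + r)⁵ ≤ 1`, `a ≤ 1`: the smeared sum is `≥ c₀ (r / (4(3t₀ + r)))⁸`. The sub-family of pairs
`(x, x - n)` with `a x` within `r/4` of `X₀` coordinatewise and `a n` within `r/4` of `(-2t₀, 0, 0, 0)`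
has `≥ (r/4a)⁴ · (r/4a)⁴` members, each contributing `≥ 1 · 1 · c₀ (a/(3t₀ + r))⁸`. [folklore] -/
theorem twoPointSmearing_lower_core {u : SchwartzMap (EuclideanSpace ℝ (Fin 4)) ℝ} {t₀ r c₀ δ₀ a : ℝ} {L : ℕ}
    (hr : 0 < r) (hrt : r ≤ t₀) (hrδ : r ≤ δ₀ * t₀) (hc₀ : 0 ≤ c₀) (hδ₀ : 0 < δ₀)
    (hu0 : ∀ y, 0 ≤ u y)
    (hu1 : ∀ y : EuclideanSpace ℝ (Fin 4),
      dist y (EuclideanSpace.single (0 : Fin 4) (-t₀)) ≤ r → 1 ≤ u y)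
    (ha : 0 < a) (ha1 : a ≤ 1) (har : 4 * a ≤ r) (haT : 8 * a * (3 * t₀ + r) ≤ 1)
    (haT5 : a * (3 * t₀ + r) ^ 5 ≤ 1) (hL : a ^ 2 * (L : ℝ) = 1)
    (K : Site 4 → Site 4 → ℝ) (hK0 : ∀ x y, 0 ≤ K x y)
    (hK : ∀ x n : Site 4, (∀ i, |n i| ≤ (L : ℤ)) → n 0 ≠ 0 →
      16 * |(n 0 : ℝ)| ≤ ((2 * L + 1 : ℕ) : ℝ) → |(n 0 : ℝ)| ^ 5 ≤ ((2 * L + 1 : ℕ) : ℝ) ^ 4 →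
      (∀ i, i ≠ 0 → |(n i : ℝ)| ≤ δ₀ * |(n 0 : ℝ)|) →
      c₀ * |(n 0 : ℝ)|⁻¹ ^ 8 ≤ K x (x - n)) :
    c₀ * (r / (4 * (3 * t₀ + r))) ^ 8 ≤
      ∑ x ∈ box 4 L, ∑ y ∈ (box 4 L).erase x,
        u (a • siteToE x) * thetaTest 4 u (a • siteToE y) * K x y := by
  -- the scale `ℓ = a L = 1 / a`
  obtain ⟨ℓ, hℓdef⟩ : ∃ ℓ : ℝ, ℓ = a * L := ⟨_, rfl⟩
  have hℓ : a * ℓ = 1 := by rw [hℓdef, ← mul_assoc, ← sq, hL]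
  have hℓpos : 0 < ℓ := pos_of_mul_pos_right (by rw [hℓ]; exact one_pos) ha.le
  have hLℓ : (L : ℝ) = ℓ * ℓ := by
    calc (L : ℝ) = (a * ℓ) * L := by rw [hℓ, one_mul]
      _ = ℓ * ℓ := by rw [hℓdef]; ring
  have hℓ1 : 1 ≤ ℓ := by
    calc (1 : ℝ) = a * ℓ := hℓ.symm
      _ ≤ 1 * ℓ := mul_le_mul_of_nonneg_right ha1 hℓpos.le
      _ = ℓ := one_mul ℓ
  have habs : ∀ m : ℝ, |m| = ℓ * |a * m| := fun m => by
    rw [abs_mul, abs_of_pos ha, ← mul_assoc, mul_comm ℓ a, hℓ, one_mul]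
  have scale : ∀ (m t : ℝ), |a * m| ≤ t → |m| ≤ t * ℓ := fun m t h => by
    rw [habs m, mul_comm t ℓ]
    exact mul_le_mul_of_nonneg_left h hℓpos.le
  have scale' : ∀ (m t : ℝ), t ≤ |a * m| → t * ℓ ≤ |m| := fun m t h => by
    rw [habs m, mul_comm t ℓ]
    exact mul_le_mul_of_nonneg_left h hℓpos.le
  -- the size parameter `T₀ = 3 t₀ + r`
  obtain ⟨T₀, hT₀⟩ : ∃ T : ℝ, T = 3 * t₀ + r := ⟨_, rfl⟩
  rw [← hT₀] at haT haT5 ⊢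
  have ht₀ : 0 < t₀ := lt_of_lt_of_le hr hrt
  have hT₀pos : 0 < T₀ := by rw [hT₀]; linarith
  have hTℓ : 8 * T₀ ≤ ℓ := by
    calc 8 * T₀ = ℓ * (8 * a * T₀) := by linear_combination (-8 * T₀) * hℓ
      _ ≤ ℓ * 1 := mul_le_mul_of_nonneg_left haT hℓpos.le
      _ = ℓ := mul_one ℓ
  have hT5ℓ : T₀ ^ 5 ≤ ℓ := by
    calc T₀ ^ 5 = ℓ * (a * T₀ ^ 5) := by linear_combination (-T₀ ^ 5) * hℓ
      _ ≤ ℓ * 1 := mul_le_mul_of_nonneg_left haT5 hℓpos.le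
      _ = ℓ := mul_one ℓ
  have hrℓ : 4 ≤ r * ℓ := by
    calc (4 : ℝ) = ℓ * (4 * a) := by linear_combination (-4) * hℓ
      _ ≤ ℓ * r := mul_le_mul_of_nonneg_left har hℓpos.le
      _ = r * ℓ := mul_comm _ _
  have hTℓ' : T₀ ≤ ℓ := by linarith
  -- centres and cubes
  obtain ⟨X₀, hX₀⟩ : ∃ f : Fin 4 → ℝ, f = fun i => if i = 0 then -t₀ else 0 := ⟨_, rfl⟩
  obtain ⟨D, hD⟩ : ∃ f : Fin 4 → ℝ, f = fun i => if i = 0 then -(2 * t₀) else 0 := ⟨_, rfl⟩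
  have hX₀0 : X₀ 0 = -t₀ := by rw [hX₀]; simp
  have hX₀i : ∀ i, i ≠ 0 → X₀ i = 0 := fun i hi => by rw [hX₀]; simp [hi]
  have hD0 : D 0 = -(2 * t₀) := by rw [hD]; simp
  have hDi : ∀ i, i ≠ 0 → D i = 0 := fun i hi => by rw [hD]; simp [hi]
  obtain ⟨Xs, hXs⟩ : ∃ s : Finset (Site 4),
      s = Fintype.piFinset fun i => Finset.Icc ⌈(X₀ i - r / 4) / a⌉ ⌊(X₀ i + r / 4) / a⌋ :=
    ⟨_, rfl⟩
  obtain ⟨Ns, hNs⟩ : ∃ s : Finset (Site 4),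
      s = Fintype.piFinset fun i => Finset.Icc ⌈(D i - r / 4) / a⌉ ⌊(D i + r / 4) / a⌋ :=
    ⟨_, rfl⟩
  have hXmem : ∀ x ∈ Xs, |a * x 0 + t₀| ≤ r / 4 ∧ ∀ i, i ≠ 0 → |a * (x i : ℝ)| ≤ r / 4 := by
    intro x hx
    rw [hXs, tps_mem_cube_iff ha] at hx
    refine ⟨?_, fun i hi => ?_⟩
    · have h := hx 0
      rwa [hX₀0, sub_neg_eq_add] at h
    · have h := hx i
      rwa [hX₀i i hi, sub_zero] at h
  have hNmem : ∀ n ∈ Ns, |a * n 0 + 2 * t₀| ≤ r / 4 ∧ ∀ i, i ≠ 0 → |a * (n i : ℝ)| ≤ r / 4 := by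
    intro n hn
    rw [hNs, tps_mem_cube_iff ha] at hn
    refine ⟨?_, fun i hi => ?_⟩
    · have h := hn 0
      rwa [hD0, sub_neg_eq_add] at h
    · have h := hn i
      rwa [hDi i hi, sub_zero] at h
  -- counting
  have hcount : ∀ c : Fin 4 → ℝ, (r * ℓ / 4) ^ 4 ≤
      #(Fintype.piFinset fun i => Finset.Icc ⌈(c i - r / 4) / a⌉ ⌊(c i + r / 4) / a⌋) := by
    intro c
    refine tps_pow_four_le_card_piFinset (by positivity) fun i => ?_
    have h := tps_le_card_Icc_ceil_floor ((c i - r / 4) / a) ((c i + r / 4) / a)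
    have hainv : a⁻¹ = ℓ := inv_eq_of_mul_eq_one_right hℓ
    have e : (c i + r / 4) / a - (c i - r / 4) / a - 1 = r * ℓ / 2 - 1 := by
      simp only [div_eq_mul_inv, hainv]
      ring
    linarith
  have hcardX : (r * ℓ / 4) ^ 4 ≤ #Xs := by rw [hXs]; exact hcount X₀
  have hcardN : (r * ℓ / 4) ^ 4 ≤ #Ns := by rw [hNs]; exact hcount D
  -- integer bounds from real bounds
  have hbox : ∀ m : ℤ, |a * (m : ℝ)| ≤ T₀ → |m| ≤ (L : ℤ) := fun m hm => by
    apply tps_int_abs_le_natCast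
    calc |(m : ℝ)| ≤ T₀ * ℓ := scale _ _ hm
      _ ≤ ℓ * ℓ := mul_le_mul_of_nonneg_right hTℓ' hℓpos.le
      _ = L := hLℓ.symm
  have hXbox : Xs ⊆ box 4 L := by
    intro x hx
    obtain ⟨hx0, hxi⟩ := hXmem x hx
    rw [mem_box]
    intro i
    refine abs_le.1 (hbox (x i) ?_)
    rcases eq_or_ne i 0 with rfl | hi
    · rw [show a * ((x 0 : ℤ) : ℝ) = (a * x 0 + t₀) - t₀ by ring]
      calc |(a * (x 0 : ℝ) + t₀) - t₀| ≤ |a * (x 0 : ℝ) + t₀| + |t₀| := abs_sub _ _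
        _ ≤ T₀ := by rw [abs_of_pos ht₀, hT₀]; linarith
    · exact (hxi i hi).trans (by rw [hT₀]; linarith)
  -- coordinates of the smeared points
  have c1 : ∀ (z : Site 4) (i : Fin 4), (a • siteToE z) i = a * z i := fun z i => by simp
  have c2 : (EuclideanSpace.single (0 : Fin 4) (-t₀) : EuclideanSpace ℝ (Fin 4)) 0 = -t₀ := by
    simp
  have c3 : ∀ i : Fin 4, i ≠ 0 →
      (EuclideanSpace.single (0 : Fin 4) (-t₀) : EuclideanSpace ℝ (Fin 4)) i = 0 := fun i hi => by
    simp [hi]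
  -- the per-pair facts
  have key : ∀ x ∈ Xs, ∀ n ∈ Ns, x - n ∈ box 4 L ∧ x - n ≠ x ∧
      c₀ * (T₀ * ℓ)⁻¹ ^ 8 ≤
        u (a • siteToE x) * thetaTest 4 u (a • siteToE (x - n)) * K x (x - n) := by
    intro x hx n hn
    obtain ⟨hx0, hxi⟩ := hXmem x hx
    obtain ⟨hn0, hni⟩ := hNmem n hn
    obtain ⟨hn0l, hn0u⟩ := abs_le.1 hn0
    have hn0neg : a * (n 0 : ℝ) < 0 := by linarith
    have hn0abs : |a * (n 0 : ℝ)| = -(a * n 0) := abs_of_neg hn0neg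
    have hn0T : |a * (n 0 : ℝ)| ≤ T₀ := by rw [hn0abs, hT₀]; linarith
    have hn0low : 2 * t₀ - r / 4 ≤ |a * (n 0 : ℝ)| := by rw [hn0abs]; linarith
    have hnz : n 0 ≠ 0 := by
      intro h
      rw [h, Int.cast_zero, mul_zero] at hn0neg
      exact lt_irrefl _ hn0neg
    have hsub : ∀ i, (((x - n) i : ℤ) : ℝ) = x i - n i := fun i => by simp
    -- (1) membership in the box
    have hmem : x - n ∈ box 4 L := by
      rw [mem_box]
      intro i
      refine abs_le.1 (hbox ((x - n) i) ?_)
      rw [hsub, mul_sub]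
      rcases eq_or_ne i 0 with rfl | hi
      · rw [show a * (x 0 : ℝ) - a * n 0 = (a * x 0 + t₀) - (a * n 0 + 2 * t₀) + t₀ by ring]
        calc |(a * (x 0 : ℝ) + t₀) - (a * n 0 + 2 * t₀) + t₀|
            ≤ |(a * (x 0 : ℝ) + t₀) - (a * n 0 + 2 * t₀)| + |t₀| := abs_add_le _ _
          _ ≤ |a * (x 0 : ℝ) + t₀| + |a * (n 0 : ℝ) + 2 * t₀| + |t₀| :=
              add_le_add (abs_sub _ _) le_rfl
          _ ≤ T₀ := by rw [abs_of_pos ht₀, hT₀]; linarith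
      · calc |a * (x i : ℝ) - a * n i| ≤ |a * (x i : ℝ)| + |a * (n i : ℝ)| := abs_sub _ _
          _ ≤ T₀ := by rw [hT₀]; linarith [hxi i hi, hni i hi]
    -- (2) the two points differ
    have hne : x - n ≠ x := by
      intro h
      rw [sub_eq_self] at h
      exact hnz (by rw [h]; rfl)
    -- (3) both bumps are `≥ 1`
    have hux : 1 ≤ u (a • siteToE x) := by
      refine hu1 _ (tps_dist_le_of_coord_le hr.le fun i => ?_)
      rcases eq_or_ne i 0 with rfl | hi
      · rw [c1, c2, sub_neg_eq_add]
        linarith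
      · rw [c1, c3 i hi, sub_zero]
        linarith [hxi i hi]
    have huy : 1 ≤ thetaTest 4 u (a • siteToE (x - n)) := by
      rw [thetaTest_apply]
      refine hu1 _ (tps_dist_le_of_coord_le hr.le fun i => ?_)
      rw [timeReflection_apply]
      rcases eq_or_ne i 0 with rfl | hi
      · rw [if_pos rfl, c1, c2, hsub, mul_sub,
          show -(a * (x 0 : ℝ) - a * n 0) - -t₀ = (a * n 0 + 2 * t₀) - (a * x 0 + t₀) by ring]
        calc |(a * (n 0 : ℝ) + 2 * t₀) - (a * x 0 + t₀)|
            ≤ |a * (n 0 : ℝ) + 2 * t₀| + |a * (x 0 : ℝ) + t₀| := abs_sub _ _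
          _ ≤ r / 2 := by linarith
      · rw [if_neg hi, c1, c3 i hi, hsub, mul_sub, sub_zero]
        calc |a * (x i : ℝ) - a * n i| ≤ |a * (x i : ℝ)| + |a * (n i : ℝ)| := abs_sub _ _
          _ ≤ r / 2 := by linarith [hxi i hi, hni i hi]
    -- (4) the kernel on the cone
    have hwrap : ∀ i, |n i| ≤ (L : ℤ) := fun i => hbox (n i) (by
      rcases eq_or_ne i 0 with rfl | hi
      · exact hn0T
      · exact (hni i hi).trans (by rw [hT₀]; linarith))
    have hn0r : |(n 0 : ℝ)| ≤ T₀ * ℓ := scale _ _ hn0T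
    have hn0r' : (2 * t₀ - r / 4) * ℓ ≤ |(n 0 : ℝ)| := scale' _ _ hn0low
    have hn0pos : 0 < |(n 0 : ℝ)| := abs_pos.2 (by exact_mod_cast hnz)
    have h16 : 16 * |(n 0 : ℝ)| ≤ ((2 * L + 1 : ℕ) : ℝ) := by
      push_cast
      rw [hLℓ]
      calc 16 * |(n 0 : ℝ)| ≤ 16 * (T₀ * ℓ) := by linarith
        _ = (16 * T₀) * ℓ := by ring
        _ ≤ (2 * ℓ) * ℓ := mul_le_mul_of_nonneg_right (by linarith) hℓpos.le
        _ ≤ 2 * (ℓ * ℓ) + 1 := by linarith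
    have h5 : |(n 0 : ℝ)| ^ 5 ≤ ((2 * L + 1 : ℕ) : ℝ) ^ 4 := by
      push_cast
      rw [hLℓ]
      calc |(n 0 : ℝ)| ^ 5 ≤ (T₀ * ℓ) ^ 5 := pow_le_pow_left₀ (abs_nonneg _) hn0r 5
        _ = T₀ ^ 5 * ℓ ^ 5 := mul_pow _ _ _
        _ ≤ ℓ * ℓ ^ 5 := mul_le_mul_of_nonneg_right hT5ℓ (by positivity)
        _ = ℓ ^ 6 := by ring
        _ ≤ ℓ ^ 8 := pow_le_pow_right₀ hℓ1 (by norm_num)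
        _ = (ℓ * ℓ) ^ 4 := by ring
        _ ≤ (2 * (ℓ * ℓ) + 1) ^ 4 :=
            pow_le_pow_left₀ (by positivity) (by linarith [mul_pos hℓpos hℓpos]) 4
    have hcone : ∀ i, i ≠ 0 → |(n i : ℝ)| ≤ δ₀ * |(n 0 : ℝ)| := fun i hi => by
      have h1 : |(n i : ℝ)| ≤ r / 4 * ℓ := scale _ _ (hni i hi)
      have h2 : r / 4 ≤ δ₀ * (2 * t₀ - r / 4) := by
        linarith [mul_le_mul_of_nonneg_left hrt hδ₀.le]
      calc |(n i : ℝ)| ≤ r / 4 * ℓ := h1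
        _ ≤ (δ₀ * (2 * t₀ - r / 4)) * ℓ := mul_le_mul_of_nonneg_right h2 hℓpos.le
        _ = δ₀ * ((2 * t₀ - r / 4) * ℓ) := by ring
        _ ≤ δ₀ * |(n 0 : ℝ)| := mul_le_mul_of_nonneg_left hn0r' hδ₀.le
    have hKlow : c₀ * (T₀ * ℓ)⁻¹ ^ 8 ≤ K x (x - n) := by
      refine le_trans ?_ (hK x n hwrap hnz h16 h5 hcone)
      exact mul_le_mul_of_nonneg_left
        (pow_le_pow_left₀ (by positivity) (inv_anti₀ hn0pos hn0r) 8) hc₀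
    refine ⟨hmem, hne, ?_⟩
    calc c₀ * (T₀ * ℓ)⁻¹ ^ 8 = 1 * 1 * (c₀ * (T₀ * ℓ)⁻¹ ^ 8) := by ring
      _ ≤ u (a • siteToE x) * thetaTest 4 u (a • siteToE (x - n)) * K x (x - n) :=
          mul_le_mul (mul_le_mul hux huy zero_le_one (by linarith)) hKlow (by positivity)
            (mul_nonneg (by linarith) (by linarith))
  -- assembling
  have hF0 : ∀ x y : Site 4, 0 ≤ u (a • siteToE x) * thetaTest 4 u (a • siteToE y) * K x y :=
    fun x y => mul_nonneg (mul_nonneg (hu0 _) (by rw [thetaTest_apply]; exact hu0 _)) (hK0 x y)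
  have hcomb := tps_subfamily_le_sum_erase
    (F := fun x y => u (a • siteToE x) * thetaTest 4 u (a • siteToE y) * K x y) hF0 hXbox key
  calc c₀ * (r / (4 * T₀)) ^ 8 = (r * ℓ / 4) ^ 4 * (r * ℓ / 4) ^ 4 * (c₀ * (T₀ * ℓ)⁻¹ ^ 8) := by
        field_simp
    _ ≤ (#Xs : ℝ) * #Ns * (c₀ * (T₀ * ℓ)⁻¹ ^ 8) :=
        mul_le_mul_of_nonneg_right (mul_le_mul hcardX hcardN (by positivity) (Nat.cast_nonneg _))
          (by positivity)
    _ ≤ _ := hcomb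

/-- **Lower half of `stub_twoPointSmearing`**: there is `δ₁ > 0` such that for a nonnegative bump `u`
equal to `≥ 1` on the ball of radius `r ≤ δ₁ t₀` about `(-t₀, 0, 0, 0)` the smeared tree-level
two-point kernel of the reflected pair `(u, θu)` is bounded below by a positive constant, uniformly in
small lattice spacing `a ≤ a₀`, `a²L = 1`. [folklore] -/
theorem twoPointSmearing_lower :
    ∃ δ₁ : ℝ, 0 < δ₁ ∧ ∀ (u : SchwartzMap (EuclideanSpace ℝ (Fin 4)) ℝ) (t₀ r : ℝ), 0 < r → r ≤ δ₁ * t₀ →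
      (∀ y, 0 ≤ u y) →
      (∀ y : EuclideanSpace ℝ (Fin 4), dist y (EuclideanSpace.single (0 : Fin 4) (-t₀)) ≤ r → 1 ≤ u y) →
      ∃ c a₀ : ℝ, 0 < c ∧ 0 < a₀ ∧ ∀ (a : ℝ), 0 < a → a ≤ a₀ → ∀ (L : ℕ), a ^ 2 * (L : ℝ) = 1 →
      ∀ (H : TorusSite 4 (2 * L + 1) → Fin 4 → Fin 4 → ℝ),
      (∀ z i j, H z i j = torusGreen (z + Pi.single i 1) - torusGreen (z + Pi.single i 1 - Pi.single j 1) -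
        torusGreen z + torusGreen (z - Pi.single j 1)) →
      ∀ (πK : TorusSite 4 (2 * L + 1) → {q : Fin 4 × Fin 4 // q.1 < q.2} → {q : Fin 4 × Fin 4 // q.1 < q.2} → ℝ),
      (∀ n α α', πK n α α' = (1 / 2 : ℝ) * (-(H n α.1.1 α'.1.1) * (if α.1.2 = α'.1.2 then 1 else 0)
          + H n α.1.1 α'.1.2 * (if α.1.2 = α'.1.1 then 1 else 0)
          + H n α.1.2 α'.1.1 * (if α.1.1 = α'.1.2 then 1 else 0)
          - H n α.1.2 α'.1.2 * (if α.1.1 = α'.1.1 then 1 else 0))) →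
      c ≤ ∑ x ∈ box 4 L, ∑ y ∈ (box 4 L).erase x,
          u (a • siteToE x) * thetaTest 4 u (a • siteToE y) *
            ∑ α, ∑ α', (πK (Torus.proj (2 * L + 1) x - Torus.proj (2 * L + 1) y) α α') ^ 2 := by
  obtain ⟨c₀, δ₀, hc₀, hδ₀, hK⟩ := twoPointKernel_lower_noWrap
  refine ⟨min 1 δ₀, lt_min one_pos hδ₀, ?_⟩
  intro u t₀ r hr hrδ₁ hu0 hu1
  have ht₀ : 0 < t₀ := pos_of_mul_pos_right (hr.trans_le hrδ₁) (le_min zero_le_one hδ₀.le)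
  have hrt : r ≤ t₀ :=
    hrδ₁.trans ((mul_le_mul_of_nonneg_right (min_le_left _ _) ht₀.le).trans_eq (one_mul _))
  have hrδ : r ≤ δ₀ * t₀ := hrδ₁.trans (mul_le_mul_of_nonneg_right (min_le_right _ _) ht₀.le)
  have hT : 0 < 3 * t₀ + r := by linarith
  refine ⟨c₀ * (r / (4 * (3 * t₀ + r))) ^ 8,
    min (min 1 (r / 4)) (min (1 / (8 * (3 * t₀ + r))) (1 / (3 * t₀ + r) ^ 5)),
    by positivity, by positivity, ?_⟩
  intro a ha ha₀ L hL H hH πK hπK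
  have ha1 : a ≤ 1 := ha₀.trans ((min_le_left _ _).trans (min_le_left _ _))
  have har : 4 * a ≤ r := by
    have h := ha₀.trans ((min_le_left _ _).trans (min_le_right _ _))
    linarith
  have haT : 8 * a * (3 * t₀ + r) ≤ 1 := by
    have h := ha₀.trans ((min_le_right _ _).trans (min_le_left _ _))
    rw [le_div_iff₀ (by positivity)] at h
    linarith
  have haT5 : a * (3 * t₀ + r) ^ 5 ≤ 1 := by
    have h := ha₀.trans ((min_le_right _ _).trans (min_le_right _ _))
    rw [le_div_iff₀ (by positivity)] at h
    linarith
  exact twoPointSmearing_lower_core hr hrt hrδ hc₀.le hδ₀ hu0 hu1 ha ha1 har haT haT5 hL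
    (fun x y => ∑ α, ∑ α', (πK (Torus.proj (2 * L + 1) x - Torus.proj (2 * L + 1) y) α α') ^ 2)
    (fun x y => Finset.sum_nonneg fun _ _ => Finset.sum_nonneg fun _ _ => sq_nonneg _)
    (fun x n hw hn0 h16 h5 hcone => hK L H hH πK hπK x n hw hn0 h16 h5 hcone)

/-! ### The stub -/

/-- **Stub `stub_twoPointSmearing`** of line `Sketch` (crux `SelfNormalisedSkewness`, registered
signature, verbatim): the smeared tree-level two-point kernel
`TP(u) = ∑_{x ≠ y ∈ box 4 L} u(a x) (θu)(a y) ∑_{αα'} π_{αα'}(x - y)²` of a reflected pair of bumps is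
of exact order one in the lattice spacing: (UPPER) bounded for `u` supported in `{y₀ ≤ -ρ₀} ∩ B(0, R)`,
`2aR ≤ 1`; (LOWER) bounded below by `c > 0` for a nonnegative bump `≥ 1` on a ball of radius
`r ≤ δ₁ t₀` about `(-t₀, 0, 0, 0)`, for `a ≤ a₀`. [folklore] -/
theorem stub_twoPointSmearing :
    (∀ (u : SchwartzMap (EuclideanSpace ℝ (Fin 4)) ℝ) (R ρ₀ : ℝ), 0 < ρ₀ →
      tsupport u ⊆ {y : EuclideanSpace ℝ (Fin 4) | y 0 ≤ -ρ₀} →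
      tsupport u ⊆ Metric.closedBall (0 : EuclideanSpace ℝ (Fin 4)) R →
      ∃ C : ℝ, ∀ (a : ℝ), 0 < a → a ≤ 1 → 2 * a * R ≤ 1 → ∀ (L : ℕ), a ^ 2 * (L : ℝ) = 1 →
      ∀ (H : TorusSite 4 (2 * L + 1) → Fin 4 → Fin 4 → ℝ),
      (∀ z i j, H z i j = torusGreen (z + Pi.single i 1) - torusGreen (z + Pi.single i 1 - Pi.single j 1) -
        torusGreen z + torusGreen (z - Pi.single j 1)) →
      ∀ (πK : TorusSite 4 (2 * L + 1) → {q : Fin 4 × Fin 4 // q.1 < q.2} → {q : Fin 4 × Fin 4 // q.1 < q.2} → ℝ),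
      (∀ n α α', πK n α α' = (1 / 2 : ℝ) * (-(H n α.1.1 α'.1.1) * (if α.1.2 = α'.1.2 then 1 else 0)
          + H n α.1.1 α'.1.2 * (if α.1.2 = α'.1.1 then 1 else 0)
          + H n α.1.2 α'.1.1 * (if α.1.1 = α'.1.2 then 1 else 0)
          - H n α.1.2 α'.1.2 * (if α.1.1 = α'.1.1 then 1 else 0))) →
      ∑ x ∈ box 4 L, ∑ y ∈ (box 4 L).erase x,
          u (a • siteToE x) * thetaTest 4 u (a • siteToE y) *
            ∑ α, ∑ α', (πK (Torus.proj (2 * L + 1) x - Torus.proj (2 * L + 1) y) α α') ^ 2 ≤ C) ∧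
    (∃ δ₁ : ℝ, 0 < δ₁ ∧ ∀ (u : SchwartzMap (EuclideanSpace ℝ (Fin 4)) ℝ) (t₀ r : ℝ), 0 < r → r ≤ δ₁ * t₀ →
      (∀ y, 0 ≤ u y) →
      (∀ y : EuclideanSpace ℝ (Fin 4), dist y (EuclideanSpace.single (0 : Fin 4) (-t₀)) ≤ r → 1 ≤ u y) →
      ∃ c a₀ : ℝ, 0 < c ∧ 0 < a₀ ∧ ∀ (a : ℝ), 0 < a → a ≤ a₀ → ∀ (L : ℕ), a ^ 2 * (L : ℝ) = 1 →
      ∀ (H : TorusSite 4 (2 * L + 1) → Fin 4 → Fin 4 → ℝ),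
      (∀ z i j, H z i j = torusGreen (z + Pi.single i 1) - torusGreen (z + Pi.single i 1 - Pi.single j 1) -
        torusGreen z + torusGreen (z - Pi.single j 1)) →
      ∀ (πK : TorusSite 4 (2 * L + 1) → {q : Fin 4 × Fin 4 // q.1 < q.2} → {q : Fin 4 × Fin 4 // q.1 < q.2} → ℝ),
      (∀ n α α', πK n α α' = (1 / 2 : ℝ) * (-(H n α.1.1 α'.1.1) * (if α.1.2 = α'.1.2 then 1 else 0)
          + H n α.1.1 α'.1.2 * (if α.1.2 = α'.1.1 then 1 else 0)
          + H n α.1.2 α'.1.1 * (if α.1.1 = α'.1.2 then 1 else 0)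
          - H n α.1.2 α'.1.2 * (if α.1.1 = α'.1.1 then 1 else 0))) →
      c ≤ ∑ x ∈ box 4 L, ∑ y ∈ (box 4 L).erase x,
          u (a • siteToE x) * thetaTest 4 u (a • siteToE y) *
            ∑ α, ∑ α', (πK (Torus.proj (2 * L + 1) x - Torus.proj (2 * L + 1) y) α α') ^ 2) := by
  exact ⟨twoPointSmearing_upper, twoPointSmearing_lower⟩

end Summit.QuantumFields.YangMills.Theorems.SelfNormalisedSkewness.Negative

end
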